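import Summits.QuantumFields.YangMills.Theorems.FluctuationComparisonRegPrIntLHeightwiseQuotientOfBounds5
import Summits.QuantumFields.YangMills.Theorems.FluctuationComparisonRegPrIntLPersistenceFromHeightwiseBounds
import Summits.QuantumFields.YangMills.Theorems.FluctuationComparisonRegPrIntLPersistenceKFree
import Literature.MathematicalPhysics.QuantumFieldTheory.Balaban1983to89.T3Thresholds
import Literature.MathematicalPhysics.QuantumFieldTheory.Balaban1983to89.T3InteriorExcision
import Literature.MathematicalPhysics.QuantumFieldTheory.Balaban1983to89.T3PrintedMinimiserExistence
import Literature.MathematicalPhysics.QuantumFieldTheory.Balaban1983to89.B10Eq41TorusHistories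
import Literature.MathematicalPhysics.QuantumFieldTheory.Balaban1983to89.B10Eq5RegularAction
import HarnessLib

/-!
# `FluctuationComparisonRegPrIntLHeightwisePersistenceOfBounds5` — (Q5-KNIT): PERS₁∘ `OneLevelPersistenceIntCan` VERBATIM FROM BAŁABAN'S THEOREM 1 (5), BOTH HALVES, IN PRINT'S
# NORMALISATION (+ ⟨SMALL-MASS₁(S′)⟩ in §3; NOTHING ELSE in §5) — the threshold compatibility DISCHARGED for all heights at once
# (crux `UnitScaleTilt.FluctuationComparisonRegPrIntL`, stmt-QuantumFields-20520; LINE g22-2∕g22-4 row PERS₁∘; sibling of ✓`…HeightwiseQuotientOfBounds5` (Q5) and of LEAD w3-20520 g18's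
# ✓`…PersistenceFromHeightwiseBounds`)

Cell `ym3-torus` (YM ladder rung R3 = continuum SU(2) Yang–Mills on T³ — a RUNG, NOT the Clay problem: not d = 4, not infinite volume, not a mass gap);
width seat `ym-ust-20520-w5` (gen 17); helper `--supports stmt-QuantumFields-20520`.  THEOREMS ONLY (0 `def`, 0 `sorry`, default heartbeats).

WHY.  ✓`…PersistenceFromHeightwiseBounds` (LEAD) knits PERS₁∘ from letter (i) `HeightwiseUpperBound F γ`, letter (ii) a quotient-lower bound on the level-`(J+1)` INTERIOR WINDOW
`{PlaqSmall θ_{J+1}(c·b₀)}`, and ⟨SMALL-MASS₁(S′)⟩; its ★`low_of_heightwiseLowerBoundOnSmall` reaches (ii) from the lit schema only under a DISPLAYED compatibility `θ_{J+1}(c·b₀) ≤ δ`,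
and lit's `HeightwiseLowerBoundOnSmall` lets `δ = δ_n` vary with the height — while PERS₁∘'s prefix fixes `γ₁` BEFORE `J`.  Print has no such seam: (4) p. 256 is ONE threshold
«|U(∂p) − 1| < ε₁» for every step (and every volume).  ✓(Q5) converted print's two-sided (5) (normalisation `e^{−E_K}`) into the quotient letters; THIS FILE closes the seam:
* §1 ★★`heightwiseLowerUniform_of_bounds5TwoSided` — the quotient lower letter with a HEIGHT-UNIFORM threshold `δ` (constants `c_n` per height), from (5) both halves;
* §2 ★★`regularityLetter_of_thm1GlobalMinAt` — the K-UNIFORM REGULARITY letter `β_K·minAction_{n,K}(V) ≤ 12(B₃ε₁)²L^{3m+4n}∕γ` on `{PlaqSmall ε₁}` (the one (Q5) §4 displays) FROM THE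
  TREE'S TYPED [Balaban1985Variational] schema lit `T3PrintedMinimiserExistence.Thm1GlobalMinAt L a₀ a₁ B₃` (the EX display's `hThm2S`-class input): its regular fibre point has fine
  plaquettes `< B₃ε₁L^{−2(K−n)}`, so `A ≤ 12(B₃ε₁)²L^{3(m+K)−4(K−n)}` and `β_K = L^K∕γ` makes the product K-FREE (lit ✓`minAction_le`; the a-priori face-section bound
  lit ✓`T3SectionAction.minAction_le_pow_mul` is K-divergent and is NOT used); ★`bounds5LowerOnSmall_of_minimiserShape_thm1` — print's literal lower (5) (minimiser currency) +
  `Thm1GlobalMinAt` ⟹ the folded lower letter with ONE threshold `ε₁` for all heights;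
* §3 ★★★`oneLevelPersistenceIntCan_of_bounds5TwoSided_smallMass` — PERS₁∘ VERBATIM from: after `c, b₀, p₀` ONE `δ > 0`; after `F, γ` a normalisation `E` with `Bounds5UpperAtHeight F γ E`
  and the (5)-lower letter on `{PlaqSmall δ}` at every height; and ⟨SMALL-MASS₁(S′)⟩ per `J` — `γ₁` shrunk inside by lit ✓`exists_gamma_forall_θBal_le` so that `θ_{J+1}(c·b₀) ≤ δ` for ALL `J`.
* §4 ★★`sectionTubeMassIntCan_of_bounds5TwoSided_haarTube` — the same service for TUBE∘ (LEAD ✓`sectionTubeMassIntCan_of_up_low_haarTube`; its ⟨LOW⟩ on `{PlaqSmall 2θ_{J+1}(b₀)}`).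
* §5 ★★★★`oneLevelPersistenceIntCan_of_bounds5TwoSided` — THE CAPSTONE: PERS₁∘ VERBATIM from Theorem 1 (5) both halves AND NOTHING ELSE, the K-free side being px8 g14's hypothesis-free
  ✓`FluctuationComparisonRegPrIntLPersistenceKFree.oneLevelPersistenceIntCan_of_up_low` (p765564).
* §6 (v1.2) ★★★★`oneLevelPersistenceIntCan_of_bounds5TwoSided_balabanWindow` — EDITION OF RECORD: (5)-lower on PRINT'S OWN window `{PlaqSmall θBal_n(b₀)}` ((7): `ε₁ = g_kp(g_k)`).
NET (census): PERS₁∘ ⟸ {THM 1 (5) two-sided at every height, print's normalisation, print's single threshold} + ⟨SMALL-MASS₁(S′)⟩ — no (6), no quotient letter, no displayed compatibility.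
HONEST SCOPE.  A door; the hypotheses are print's Thm 1 for Bałaban's run objects (the cell's construction statement for `ℰp`, lit docstring) and [Balaban1985Averaging] Prop. 1's
kinematics; nothing of Bałaban's is proved; PERS₁∘∕POS∘∕TUBE∘∕LFR♯ᶜ∘∕S2β∕20520∕`YM3TorusSU2` NOT proved; the Yang–Mills mass gap is NOT proved.
HYP-SAT (cell RULING №42).  `δ` after `c, b₀, p₀` and before `γ₁, F` (print: `ε₁` depends on the coupling class only); `E`, `c_n`, `O1_n` after `F, γ, n`, before `K`; class (1) conditional door.
References: [Balaban1985UV3] (1)–(6) pp.256–257, Thm 1 p.257, (47) p.267; [Balaban1985Averaging] (10) p.19, Prop. 1 p.22.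
-/

noncomputable section

set_option autoImplicit false

open MeasureTheory Filter Topology Set
open scoped ENNReal
open Literature.MathematicalPhysics.QuantumFieldTheory.Balaban1983to89
open Literature.MathematicalPhysics.QuantumFieldTheory.Balaban1983to89.T3ContinuumYM3Torus
open Literature.MathematicalPhysics.QuantumFieldTheory.Balaban1983to89.T3UnitLawDensityEML
open Literature.MathematicalPhysics.QuantumFieldTheory.Balaban1983to89.T3UnitScaleTilt
open Literature.MathematicalPhysics.QuantumFieldTheory.Balaban1983to89.T3TiltDescent
open Literature.MathematicalPhysics.QuantumFieldTheory.Balaban1983to89.T3HeightwiseDensityBounds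
open Literature.MathematicalPhysics.QuantumFieldTheory.Balaban1983to89.T3Thresholds
open Literature.MathematicalPhysics.QuantumFieldTheory.Balaban1983to89.T3ConstrainedMinimiser
open Literature.MathematicalPhysics.QuantumFieldTheory.Balaban1983to89.T3RegularMinimiser
open Literature.MathematicalPhysics.QuantumFieldTheory.Balaban1983to89.T3PrintedRegularMinimiser
open Literature.MathematicalPhysics.QuantumFieldTheory.Balaban1983to89.T3PrintedMinimiserExistence
open Literature.MathematicalPhysics.QuantumFieldTheory.Balaban1983to89.Missing

namespace Summit.QuantumFields.YangMills.Theorems.FluctuationComparisonRegPrIntLHeightwisePersistenceOfBounds5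

open Summit.QuantumFields.YangMills.Theorems.FluctuationComparisonRegPrIntLHeightwiseQuotientOfBounds5
open Summit.QuantumFields.YangMills.Theorems.FluctuationComparisonRegPrIntLPersistenceFromHeightwiseBounds
open Summit.QuantumFields.YangMills.Theorems.FluctuationComparisonRegPrIntLPersistenceKFree

/-! ## §1 The quotient lower letter with a height-uniform threshold -/

/-- ★★ **THE QUOTIENT LOWER LETTER WITH A HEIGHT-UNIFORM THRESHOLD** (print's (4): ONE `ε₁` for all `k`): if the (5)-lower letter holds on `{PlaqSmall δ}` with the SAME `δ` at
every height (constants `c_n` per height, normalisation `E`), and `Bounds5UpperAtHeight F γ E`, then `∀ n, ∃ c'_n > 0, ∀ K ≥ n`, a.e. on `{PlaqSmall δ}`: `c'_n ≤ Z_K⁻¹ρ_{K−n}`.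
[cite: Balaban1985UV3, (4)-(5) p.256, (47) p.267] -/
theorem heightwiseLowerUniform_of_bounds5TwoSided {F : T3Family} {γ : ℝ} (hγ : 0 ≤ γ) {E : ℕ → ℝ} (h5 : Bounds5UpperAtHeight F γ E)
    {δ : ℝ} (hδ : 0 < δ)
    (h5low : ∀ n : ℕ, ∃ c : ℝ, 0 < c ∧ ∀ (K : ℕ) (hK : n ≤ K),
      ∀ᵐ V ∂(fieldMeasure (F.P n) 0 (Matrix.specialUnitaryGroup (Fin 2) ℂ)), PlaqSmall δ V →
        c ≤ Real.exp (-E K) * heightDensity F γ hK Set.univ V) (n : ℕ) :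
    ∃ c : ℝ, 0 < c ∧ ∀ (K : ℕ) (hK : n ≤ K), ∀ᵐ V ∂(fieldMeasure (F.P n) 0 (Matrix.specialUnitaryGroup (Fin 2) ℂ)), PlaqSmall δ V →
      c ≤ (partitionFn (G := Matrix.specialUnitaryGroup (Fin 2) ℂ) (F.P K) ((F.scheme ℰp γ).β K))⁻¹ * heightDensity F γ hK Set.univ V := by
  obtain ⟨O1, hO1⟩ := h5 n
  obtain ⟨c, hc, hlow⟩ := h5low n
  haveI := isProbabilityMeasure_fieldMeasure (G := Matrix.specialUnitaryGroup (Fin 2) ℂ) (F.P n) 0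
  have hppos := measureReal_plaqSmall_pos (F.P n) 0 hδ
  refine ⟨c / Real.exp (O1 * ((F.P n).sitesPerDir 0 : ℝ) ^ 3), div_pos hc (Real.exp_pos _), fun K hK => ?_⟩
  obtain ⟨hdm, hdi⟩ := heightDensity_props F hK MeasurableSet.univ hγ
  have h := quotient_lower_ae (μ := fieldMeasure (F.P n) 0 (Matrix.specialUnitaryGroup (Fin 2) ℂ)) hdi
    (heightDensity_nonneg F γ hK Set.univ) (measurableSet_plaqSmall_window (F.P n) 0 δ) hppos (Real.exp_pos (-E K)) hc
    (hO1 K hK) (hlow K hK)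
  rw [integral_heightDensity_univ_eq_partitionFn F hγ hK] at h
  filter_upwards [h] with V hV hVs
  exact hV hVs


/-! ## §2 The regularity letter from the tree's typed [Balaban1985Variational] Thm 1 schema -/

/-- On `SU(2)` the Wilson action of a finest-lattice field of run `K` with all plaquettes `< a` (`a ≥ 0`) is `≤ 12a²·L^{3(m+K)}` (`24L^{3(m+K)}` plaquettes, lit
✓`card_plaq_three`∕✓`Site.card_site`; `1 − Re tr ≤ ½|·−1|²`, lit ✓`one_sub_reTr_le_specialUnitaryGroup`). [cite: Balaban1985UV3, (11) p.258] -/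
theorem wilsonAction4_le_of_plaqSmall_run (F : T3Family) (K : ℕ) {a : ℝ} (ha : 0 ≤ a)
    {U : GaugeField (F.P K) 0 (Matrix.specialUnitaryGroup (Fin 2) ℂ)} (hU : PlaqSmall a U) :
    wilsonAction4 U ≤ 12 * a ^ 2 * (F.L : ℝ) ^ (3 * (F.m + K)) := by
  have hcard : (Fintype.card (Plaq (F.P K) 0) : ℝ) = 24 * (F.L : ℝ) ^ (3 * (F.m + K)) := by
    rw [B10Eq41TorusHistories.card_plaq_three rfl, Site.card_site]
    show ((3 * (2 * F.L ^ (F.m + K - 0)) ^ 3 : ℕ) : ℝ) = _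
    rw [show F.m + K - 0 = F.m + K by omega]
    push_cast
    ring
  unfold wilsonAction4 wilsonAction
  calc ∑ p : Plaq (F.P K) 0, 1 * (1 - reTr (GaugeField.plaqHol U p)) ≤ ∑ _p : Plaq (F.P K) 0, 1 / 2 * a ^ 2 :=
        Finset.sum_le_sum fun p _ => by
          rw [one_mul]
          refine (B10Eq5RegularAction.one_sub_reTr_le_specialUnitaryGroup _).trans ?_
          have h1 := (hU p).le
          have h0 := GaugeGroup.dist1_nonneg (GaugeField.plaqHol U p)
          nlinarith
    _ = 12 * a ^ 2 * (F.L : ℝ) ^ (3 * (F.m + K)) := by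
        rw [Finset.sum_const, Finset.card_univ, nsmul_eq_mul, hcard]; ring

/-- ★★ **THE K-UNIFORM REGULARITY LETTER FROM `Thm1GlobalMinAt`** ([Balaban1985Variational] Thm 1 + Prop 7, the tree's typed schema): for `F.L = L`, `γ > 0`, `n < K`,
`0 < ε₁ ≤ a₁`, `0 ≤ B₃`, `B₃ε₁ ≤ ε₀ ≤ a₀`, and every datum `V` with `PlaqSmall ε₁ V`:  `β_K · minAction_{n,K}(V) ≤ 12(B₃ε₁)²L^{3m+4n}∕γ` — INDEPENDENT OF `K`.  The schema's point
of print's space (8) lies over `V` with fine plaquettes `< B₃ε₁L^{−2(K−n)}` (lit `regFibrePr`∕`regThreshold`), hence action `≤ 12(B₃ε₁)²L^{3(m+K)}L^{−4(K−n)}`, and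
`β_K = L^K∕γ` (lit `scheme_β_eq`, `rfl`) cancels every `K` (lit ✓`minAction_le`).  This is exactly the «regularity of `U_k`» that converts print's (5)-lower currency
`exp[−(1∕g_k²)A^η(U_k(U)) − O(1)|T₁^{(k)}|]` into a constant on the small set (lit `T3HeightwiseDensityBounds` docstring). [cite: Balaban1985Variational, Thm 1 p.279 and Prop 7 p.299] -/
theorem regularityLetter_of_thm1GlobalMinAt {L : ℕ} {a₀ a₁ B₃ : ℝ} (hT : Thm1GlobalMinAt L a₀ a₁ B₃) {F : T3Family} (hF : F.L = L)
    {γ : ℝ} (hγ : 0 < γ) {n K : ℕ} (hnK : n < K) {ε₁ ε₀ : ℝ} (hε₁ : 0 < ε₁) (hε₁a : ε₁ ≤ a₁) (hB₃ : 0 ≤ B₃) (hlo : B₃ * ε₁ ≤ ε₀) (hhi : ε₀ ≤ a₀) :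
    ∀ V : GaugeField (F.P n) 0 (Matrix.specialUnitaryGroup (Fin 2) ℂ), PlaqSmall ε₁ V →
      (F.scheme ℰp γ).β K * minAction F ℰp n K hnK.le V ≤ 12 * (B₃ * ε₁) ^ 2 / γ * (F.L : ℝ) ^ (3 * F.m + 4 * n) := by
  intro V hV
  obtain ⟨U, hU8, -⟩ := hT F hF n K hnK ε₁ ε₀ hε₁ hε₁a hlo hhi V hV
  have hfib : descendTo F ℰp n K hnK.le U = V := hU8.1.1
  have hreg : PlaqSmall (regThreshold F n K (B₃ * ε₁)) U := hU8.1.2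
  have hL : (0 : ℝ) < F.L := by have := F.hL.2; exact_mod_cast (by omega : 0 < F.L)
  have hthr : 0 ≤ regThreshold F n K (B₃ * ε₁) := by
    unfold regThreshold; positivity
  have hA := wilsonAction4_le_of_plaqSmall_run F K hthr hreg
  have hβ : 0 ≤ (F.scheme ℰp γ).β K := F.scheme_β_nonneg ℰp hγ.le K
  have hmin : minAction F ℰp n K hnK.le V ≤ wilsonAction4 U := minAction_le F ℰp hfib
  calc (F.scheme ℰp γ).β K * minAction F ℰp n K hnK.le V
      ≤ (F.scheme ℰp γ).β K * (12 * (regThreshold F n K (B₃ * ε₁)) ^ 2 * (F.L : ℝ) ^ (3 * (F.m + K))) :=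
        mul_le_mul_of_nonneg_left (hmin.trans hA) hβ
    _ = 12 * (B₃ * ε₁) ^ 2 / γ * (F.L : ℝ) ^ (3 * F.m + 4 * n) := by
        obtain ⟨k, rfl⟩ := Nat.exists_eq_add_of_le hnK.le
        rw [show (F.scheme ℰp γ).β (n + k) = (γ * ((F.L : ℝ)⁻¹) ^ (n + k))⁻¹ from rfl]
        unfold regThreshold
        rw [show n + k - n = k by omega]
        have hx : (F.L : ℝ) ≠ 0 := hL.ne'
        simp only [inv_pow]
        field_simp
        ring

/-- ★ **PRINT'S LITERAL LOWER (5) + `Thm1GlobalMinAt` ⟹ THE FOLDED LOWER LETTER WITH ONE THRESHOLD.**  If at every height `n` the (5)-lower bound holds in print's minimiser currency on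
`{PlaqSmall ε₁}` for runs `K > n` (normalisation `E`, `O1_n` per height) and [Balaban1985Variational] Thm 1 holds in the tree's global reading with `ε₁ ≤ a₁`, `B₃ε₁ ≤ ε₀ ≤ a₀`,
then the folded lower letter of (Q5)∕§1 holds on `{PlaqSmall ε₁}` at every height with `c_n := exp(−12(B₃ε₁)²L^{3m+4n}∕γ − O1_n·|T₁^{(K−n)}|)` — for `K > n`; the diagonal run `K = n`
(no averaging, `ρ₀` itself) is covered by the hypothesis `hdiag`. [cite: Balaban1985UV3, (5) p.256 and (47) p.267; Balaban1985Variational, Thm 1 p.279] -/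
theorem bounds5LowerOnSmall_of_minimiserShape_thm1 {L : ℕ} {a₀ a₁ B₃ : ℝ} (hT : Thm1GlobalMinAt L a₀ a₁ B₃) {F : T3Family} (hF : F.L = L)
    {γ : ℝ} (hγ : 0 < γ) {E : ℕ → ℝ} {ε₁ ε₀ : ℝ} (hε₁ : 0 < ε₁) (hε₁a : ε₁ ≤ a₁) (hB₃ : 0 ≤ B₃) (hlo : B₃ * ε₁ ≤ ε₀) (hhi : ε₀ ≤ a₀)
    (h : ∀ n : ℕ, ∃ O1 : ℝ, ∀ (K : ℕ) (hK : n ≤ K),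
      ∀ᵐ V ∂(fieldMeasure (F.P n) 0 (Matrix.specialUnitaryGroup (Fin 2) ℂ)), PlaqSmall ε₁ V →
        Real.exp (-((F.scheme ℰp γ).β K * minAction F ℰp n K hK V) - O1 * ((F.P n).sitesPerDir 0 : ℝ) ^ 3) ≤
          Real.exp (-E K) * heightDensity F γ hK Set.univ V) :
    ∀ n : ℕ, ∃ c : ℝ, 0 < c ∧ ∀ (K : ℕ) (hK : n ≤ K),
      ∀ᵐ V ∂(fieldMeasure (F.P n) 0 (Matrix.specialUnitaryGroup (Fin 2) ℂ)), PlaqSmall ε₁ V →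
        c ≤ Real.exp (-E K) * heightDensity F γ hK Set.univ V := by
  intro n
  obtain ⟨O1, hO1⟩ := h n
  -- K-uniform action bound: the regularity letter for `K > n`; at `K = n` the minimiser is the datum itself, `β_n·A(V) ≤ 12ε₁²L^{3(m+n)}·β_n`
  set A₀ : ℝ := max (12 * (B₃ * ε₁) ^ 2 / γ * (F.L : ℝ) ^ (3 * F.m + 4 * n))
    ((F.scheme ℰp γ).β n * (12 * ε₁ ^ 2 * (F.L : ℝ) ^ (3 * (F.m + n)))) with hA₀
  refine ⟨Real.exp (-A₀ - O1 * ((F.P n).sitesPerDir 0 : ℝ) ^ 3), Real.exp_pos _, fun K hK => ?_⟩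
  have hreg : ∀ V : GaugeField (F.P n) 0 (Matrix.specialUnitaryGroup (Fin 2) ℂ), PlaqSmall ε₁ V →
      (F.scheme ℰp γ).β K * minAction F ℰp n K hK V ≤ A₀ := by
    intro V hV
    rcases Nat.lt_or_ge n K with hlt | hge
    · exact (regularityLetter_of_thm1GlobalMinAt hT hF hγ hlt hε₁ hε₁a hB₃ hlo hhi V hV).trans (le_max_left _ _)
    · obtain rfl : n = K := le_antisymm hK hge
      refine le_trans ?_ (le_max_right _ _)
      refine mul_le_mul_of_nonneg_left ?_ (F.scheme_β_nonneg ℰp hγ.le n)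
      rw [T3DescentFibreTower.minAction_self F ℰp n V]
      exact wilsonAction4_le_of_plaqSmall_run F n hε₁.le hV
  filter_upwards [hO1 K hK] with V hV hVs
  refine le_trans (Real.exp_le_exp.mpr ?_) (hV hVs)
  have := hreg V hVs
  linarith

/-! ## §3 The knit -/

/-- ★★★ **PERS₁∘ `OneLevelPersistenceIntCan` VERBATIM ⟸ THEOREM 1 (5), BOTH HALVES, IN BAŁABAN'S NORMALISATION + ⟨SMALL-MASS₁(S′)⟩ — NO (6), NO QUOTIENT LETTER, NO DISPLAYED
THRESHOLD COMPATIBILITY.**  Hypothesis, in PERS₁∘'s shared prefix: after `c, b₀, p₀` ONE plaquette threshold `δ > 0` (print's (4): «|U(∂p) − 1| < ε₁», one `ε₁` for every step and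
every volume); after `F, γ` a run normalisation `E : ℕ → ℝ` (Bałaban's (1)) with (a) `Bounds5UpperAtHeight F γ E` ((5) upper, every height), (b) the (5)-LOWER letter on `{PlaqSmall δ}`
at every height (`c_n ≤ e^{−E_K}ρ_{K−n}` a.e. there), and for every `J` (c) ⟨SMALL-MASS₁(S′)⟩ verbatim.  Inside, `γ₁` is shrunk by lit ✓`exists_gamma_forall_θBal_le` so that EVERY
interior window radius `θ_{J+1}(c·b₀) ≤ δ` — the compatibility LEAD w3-20520 g18 displayed as `hδ` is DISCHARGED for all `J` at once; then ✓`heightwiseUpperBound_of_bounds5TwoSided` (letter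
(i)), `heightwiseLowerUniform_of_bounds5TwoSided` (letter (ii)) and ✓`oneLevelPersistenceIntCan_of_heightwiseBounds_smallMass` give PERS₁∘ byte for byte.
HONEST SCOPE: a door; (a)–(c) are HYPOTHESES = print's Thm 1 (5) for Bałaban's run objects (the cell's construction statement for `ℰp`) + [Balaban1985Averaging] Prop. 1's kinematics;
nothing of Bałaban's is proved; PERS₁∘∕POS∘∕LFR♯ᶜ∘∕S2β∕20520 NOT proved. [cite: Balaban1985UV3, (1)-(6) pp.256-257, Thm 1 p.257; Balaban1985Averaging, Prop. 1 p.22] -/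
theorem oneLevelPersistenceIntCan_of_bounds5TwoSided_smallMass
    (h : ∀ (L : ℕ), ∃ c₀ : ℝ, 0 < c₀ ∧ c₀ ≤ 1 ∧ ∀ (c : ℝ), 0 < c → c ≤ c₀ → ∃ pS : ℝ, ∀ (b₀ p₀ : ℝ), 0 < b₀ → pS ≤ p₀ → 0 < p₀ →
      ∃ δ : ℝ, 0 < δ ∧ ∃ γ₁ : ℝ, 0 < γ₁ ∧ ∀ (F : T3Family) (γ : ℝ), F.L = L → 0 < γ → γ ≤ γ₁ →
        (∃ E : ℕ → ℝ, Bounds5UpperAtHeight F γ E ∧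
          ∀ n : ℕ, ∃ cn : ℝ, 0 < cn ∧ ∀ (K : ℕ) (hK : n ≤ K),
            ∀ᵐ V ∂(fieldMeasure (F.P n) 0 (Matrix.specialUnitaryGroup (Fin 2) ℂ)), PlaqSmall δ V →
              cn ≤ Real.exp (-E K) * heightDensity F γ hK Set.univ V) ∧
        ∀ (J : ℕ),
          (∃ q₀ : ℝ, 0 < q₀ ∧ ∀ (B : Set (GaugeField (F.P J) 0 (Matrix.specialUnitaryGroup (Fin 2) ℂ))), MeasurableSet B →
            B ⊆ {U | PlaqSmall (θBal F.L γ (c * b₀) p₀ J) U} →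
            ENNReal.ofReal q₀ * fieldMeasure (F.P (J + 1)) 0 (Matrix.specialUnitaryGroup (Fin 2) ℂ) (descendTo F ℰp J (J + 1) (Nat.le_succ J) ⁻¹' B) ≤
              fieldMeasure (F.P (J + 1)) 0 (Matrix.specialUnitaryGroup (Fin 2) ℂ) (descendTo F ℰp J (J + 1) (Nat.le_succ J) ⁻¹' B ∩
                {V | PlaqSmall (θBal F.L γ (c * b₀) p₀ (J + 1)) V}))) :
    ∀ (L : ℕ), ∃ c₀ : ℝ, 0 < c₀ ∧ c₀ ≤ 1 ∧ ∀ (c : ℝ), 0 < c → c ≤ c₀ → ∃ pS : ℝ, ∀ (b₀ p₀ : ℝ), 0 < b₀ → pS ≤ p₀ → 0 < p₀ →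
      ∃ γ₁ : ℝ, 0 < γ₁ ∧ ∀ (F : T3Family) (γ : ℝ), F.L = L → 0 < γ → γ ≤ γ₁ →
        ∀ (J : ℕ), ∃ q : ℝ, 0 < q ∧ ∀ (K : ℕ) (hJK : J + 1 ≤ K)
          (B : Set (GaugeField (F.P J) 0 (Matrix.specialUnitaryGroup (Fin 2) ℂ))), MeasurableSet B →
            B ⊆ {U | PlaqSmall (θBal F.L γ (c * b₀) p₀ J) U} →
            ENNReal.ofReal q * gibbsK F ℰp γ K (descendTo F ℰp J K ((Nat.le_succ J).trans hJK) ⁻¹' B) ≤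
              gibbsK F ℰp γ K (descendTo F ℰp J K ((Nat.le_succ J).trans hJK) ⁻¹' B ∩
                descendTo F ℰp (J + 1) K hJK ⁻¹' {V | PlaqSmall (θBal F.L γ (c * b₀) p₀ (J + 1)) V}) := by
  refine oneLevelPersistenceIntCan_of_heightwiseBounds_smallMass fun L => ?_
  obtain ⟨c₀, hc₀, hc₀1, hc⟩ := h L
  refine ⟨c₀, hc₀, hc₀1, fun c hcpos hcle => ?_⟩
  obtain ⟨pS, hpS⟩ := hc c hcpos hcle
  refine ⟨pS, fun b₀ p₀ hb₀ hpS' hp₀ => ?_⟩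
  obtain ⟨δ, hδ, γ₁, hγ₁, hγ₁F⟩ := hpS b₀ p₀ hb₀ hpS' hp₀
  -- shrink `γ₁` so that every interior window radius is below the threshold `δ`
  obtain ⟨γθ, hγθ, -, hθ⟩ := exists_gamma_forall_θBal_le (b₀ := c * b₀) (p₀ := p₀) (mul_pos hcpos hb₀) hp₀ hδ
  refine ⟨min γ₁ γθ, lt_min hγ₁ hγθ, fun F γ hFL hγ hγle => ?_⟩
  obtain ⟨⟨E, h5, h5low⟩, hSM⟩ := hγ₁F F γ hFL hγ (hγle.trans (min_le_left _ _))
  have hL1 : 1 ≤ F.L := F.hL.2.le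
  have hθle : ∀ i : ℕ, θBal F.L γ (c * b₀) p₀ i ≤ δ := hθ F.L hL1 γ hγ (hγle.trans (min_le_right _ _))
  refine ⟨heightwiseUpperBound_of_bounds5TwoSided hγ.le h5 ⟨δ, ?_⟩, fun J => ⟨?_, hSM J⟩⟩
  · obtain ⟨c0, hc0, h0⟩ := h5low 0
    exact ⟨c0, hδ, hc0, fun K => h0 K (Nat.zero_le K)⟩
  · obtain ⟨cl, hcl, hlow⟩ := heightwiseLowerUniform_of_bounds5TwoSided hγ.le h5 hδ h5low (J + 1)
    refine ⟨cl, hcl, fun K hJK => ?_⟩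
    filter_upwards [hlow K hJK] with V hV hVs
    exact hV (fun p => (hVs p).trans_le (hθle (J + 1)))


/-! ## §4 The same for TUBE∘: `SectionTubeMassIntCan` from Theorem 1 (5), both halves, + ⟨HAAR-TUBE₁⟩ -/

/-- ★★ **TUBE∘ `SectionTubeMassIntCan` VERBATIM ⟸ THEOREM 1 (5), BOTH HALVES (print's normalisation, ONE threshold) + ⟨HAAR-TUBE₁⟩** — the row g22-4∕g22-6 keep «for its own sake»
(LEAD w3-20520 g18 ✓`sectionTubeMassIntCan_of_up_low_haarTube`: TUBE∘ ⟸ ⟨UP⟩ + ⟨LOW(2θ)⟩ + ⟨HAAR-TUBE₁⟩): its ⟨LOW⟩ sits on the wider small set `{PlaqSmall 2θ_{J+1}(b₀)}`, so `γ₁` is shrunk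
(lit ✓`exists_gamma_forall_θBal_le` at `σ := δ∕2`) until `2θ_{J+1}(b₀) ≤ δ` for all `J`; ⟨UP⟩∕⟨LOW(2θ)⟩ then come from (5) both halves exactly as in §3.  HONEST SCOPE: a door; the hypotheses
are print's Thm 1 (5) halves and the K-free Haar tube letter; TUBE∘∕PERS₁∘∕LFR♯ᶜ∘∕20520 NOT proved. [cite: Balaban1985UV3, (4)-(6) pp.256-257, Thm 1 p.257; Balaban1985Averaging, Prop. 1 p.22] -/
theorem sectionTubeMassIntCan_of_bounds5TwoSided_haarTube
    (h : ∀ (L : ℕ), ∃ c₀ : ℝ, 0 < c₀ ∧ c₀ ≤ 1 ∧ ∀ (c : ℝ), 0 < c → c ≤ c₀ → ∃ pS : ℝ, ∀ (b₀ p₀ : ℝ), 0 < b₀ → pS ≤ p₀ → 0 < p₀ →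
      ∃ δ : ℝ, 0 < δ ∧ ∃ γ₁ : ℝ, 0 < γ₁ ∧ γ₁ ≤ 1 ∧ ∀ (F : T3Family) (γ : ℝ), F.L = L → 0 < γ → γ ≤ γ₁ →
        (∃ E : ℕ → ℝ, Bounds5UpperAtHeight F γ E ∧
          ∀ n : ℕ, ∃ cn : ℝ, 0 < cn ∧ ∀ (K : ℕ) (hK : n ≤ K),
            ∀ᵐ V ∂(fieldMeasure (F.P n) 0 (Matrix.specialUnitaryGroup (Fin 2) ℂ)), PlaqSmall δ V →
              cn ≤ Real.exp (-E K) * heightDensity F γ hK Set.univ V) ∧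
        ∀ (J : ℕ) (r : ℝ), 0 < r →
            ∀ σ : GaugeField (F.P J) 0 (Matrix.specialUnitaryGroup (Fin 2) ℂ) → GaugeField (F.P (J + 1)) 0 (Matrix.specialUnitaryGroup (Fin 2) ℂ), Measurable σ →
              (∀ U : GaugeField (F.P J) 0 (Matrix.specialUnitaryGroup (Fin 2) ℂ), PlaqSmall (θBal F.L γ (c * b₀) p₀ J) U →
                descendTo F ℰp J (J + 1) (Nat.le_succ J) (σ U) = U ∧ PlaqSmall (θBal F.L γ b₀ p₀ (J + 1)) (σ U)) →
              ∃ q' : ℝ, 0 < q' ∧ ∀ (B : Set (GaugeField (F.P J) 0 (Matrix.specialUnitaryGroup (Fin 2) ℂ))), MeasurableSet B →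
                B ⊆ {U | PlaqSmall (θBal F.L γ (c * b₀) p₀ J) U} →
                ENNReal.ofReal q' * fieldMeasure (F.P (J + 1)) 0 (Matrix.specialUnitaryGroup (Fin 2) ℂ) (descendTo F ℰp J (J + 1) (Nat.le_succ J) ⁻¹' B) ≤
                  fieldMeasure (F.P (J + 1)) 0 (Matrix.specialUnitaryGroup (Fin 2) ℂ) (descendTo F ℰp J (J + 1) (Nat.le_succ J) ⁻¹' B ∩
                    {V | ∀ b : PBond (F.P (J + 1)) 0, dist1 ((σ (descendTo F ℰp J (J + 1) (Nat.le_succ J) V) b)⁻¹ * V b) < r})) :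
    ∀ (L : ℕ), ∃ c₀ : ℝ, 0 < c₀ ∧ c₀ ≤ 1 ∧ ∀ (c : ℝ), 0 < c → c ≤ c₀ → ∃ pS : ℝ, ∀ (b₀ p₀ : ℝ), 0 < b₀ → pS ≤ p₀ → 0 < p₀ →
      ∃ γ₁ : ℝ, 0 < γ₁ ∧ ∀ (F : T3Family) (γ : ℝ), F.L = L → 0 < γ → γ ≤ γ₁ →
        ∀ (J : ℕ) (r : ℝ), 0 < r →
          ∀ σ : GaugeField (F.P J) 0 (Matrix.specialUnitaryGroup (Fin 2) ℂ) → GaugeField (F.P (J + 1)) 0 (Matrix.specialUnitaryGroup (Fin 2) ℂ), Measurable σ →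
            (∀ U : GaugeField (F.P J) 0 (Matrix.specialUnitaryGroup (Fin 2) ℂ), PlaqSmall (θBal F.L γ (c * b₀) p₀ J) U →
              descendTo F ℰp J (J + 1) (Nat.le_succ J) (σ U) = U ∧ PlaqSmall (θBal F.L γ b₀ p₀ (J + 1)) (σ U)) →
            ∃ q : ℝ, 0 < q ∧ ∀ (K : ℕ) (hJK : J + 1 ≤ K)
              (B : Set (GaugeField (F.P J) 0 (Matrix.specialUnitaryGroup (Fin 2) ℂ))), MeasurableSet B →
                B ⊆ {U | PlaqSmall (θBal F.L γ (c * b₀) p₀ J) U} →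
                ENNReal.ofReal q * gibbsK F ℰp γ K (descendTo F ℰp J K ((Nat.le_succ J).trans hJK) ⁻¹' B) ≤
                  gibbsK F ℰp γ K (descendTo F ℰp J K ((Nat.le_succ J).trans hJK) ⁻¹' B ∩
                    {V | ∀ b : PBond (F.P (J + 1)) 0,
                      dist1 ((σ (descendTo F ℰp J K ((Nat.le_succ J).trans hJK) V) b)⁻¹ *
                        descendTo F ℰp (J + 1) K hJK V b) < r}) := by
  refine Summit.QuantumFields.YangMills.Theorems.FluctuationComparisonRegPrIntLSectionTubeSplit.sectionTubeMassIntCan_of_up_low_haarTube fun L => ?_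
  obtain ⟨c₀, hc₀, hc₀1, hc⟩ := h L
  refine ⟨c₀, hc₀, hc₀1, fun c hcpos hcle => ?_⟩
  obtain ⟨pS, hpS⟩ := hc c hcpos hcle
  refine ⟨pS, fun b₀ p₀ hb₀ hpS' hp₀ => ?_⟩
  obtain ⟨δ, hδ, γ₁, hγ₁, hγ₁1, hγ₁F⟩ := hpS b₀ p₀ hb₀ hpS' hp₀
  -- shrink `γ₁` so that the doubled window radius `2θ_{J+1}(b₀)` is below the threshold `δ` at every height
  obtain ⟨γθ, hγθ, -, hθ⟩ := exists_gamma_forall_θBal_le (b₀ := b₀) (p₀ := p₀) hb₀ hp₀ (half_pos hδ)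
  refine ⟨min γ₁ γθ, lt_min hγ₁ hγθ, (min_le_left _ _).trans hγ₁1, fun F γ hFL hγ hγle J => ?_⟩
  obtain ⟨⟨E, h5, h5low⟩, hHT⟩ := hγ₁F F γ hFL hγ (hγle.trans (min_le_left _ _))
  have hL1 : 1 ≤ F.L := F.hL.2.le
  have hθle : ∀ i : ℕ, 2 * θBal F.L γ b₀ p₀ i ≤ δ := fun i => by
    have := hθ F.L hL1 γ hγ (hγle.trans (min_le_right _ _)) i
    linarith
  have hup : HeightwiseUpperBound F γ := by
    refine heightwiseUpperBound_of_bounds5TwoSided hγ.le h5 ⟨δ, ?_⟩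
    obtain ⟨c0, hc0, h0⟩ := h5low 0
    exact ⟨c0, hδ, hc0, fun K => h0 K (Nat.zero_le K)⟩
  obtain ⟨C, hC, hUP⟩ := up_of_heightwiseUpperBound F hγ.le hup J
  obtain ⟨cl, hcl, hlow⟩ := heightwiseLowerUniform_of_bounds5TwoSided hγ.le h5 hδ h5low (J + 1)
  refine ⟨⟨C, cl, hC, hcl, fun K hJK => ⟨hUP K hJK _, ?_⟩⟩, hHT J⟩
  refine low_of_heightwiseLowerDensity F hγ.le hJK (measurableSet_plaqSmall _) ?_
  filter_upwards [hlow K hJK] with V hV hVs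
  exact hV (fun p => (hVs p).trans_le (hθle (J + 1)))


/-! ## §5 The capstone: PERS₁∘ from Theorem 1 (5), both halves, AND NOTHING ELSE (⟨SMALL-MASS₁(S′)⟩ is px8 g14's hypothesis-free ✓`smallMassInterior`) -/

/-- ★★★★ **PERS₁∘ `OneLevelPersistenceIntCan` VERBATIM ⟸ BAŁABAN'S THEOREM 1 (5), BOTH HALVES, IN PRINT'S NORMALISATION — AND NOTHING ELSE.**  Hypothesis, in PERS₁∘'s prefix:
after `c, b₀, p₀` ONE plaquette threshold `δ > 0` (print's (4)); after `F, γ` a run normalisation `E : ℕ → ℝ` (print's (1)) with `Bounds5UpperAtHeight F γ E` ((5) upper at every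
height, lit schema) and the (5)-LOWER letter `c_n ≤ e^{−E_K}ρ_{K−n}` a.e. on `{PlaqSmall δ}` at every height `n ≤ K`.  Conclusion: PERS₁∘ byte for byte.  The K-FREE side is the tree's
HYPOTHESIS-FREE ✓`FluctuationComparisonRegPrIntLPersistenceKFree.oneLevelPersistenceIntCan_of_up_low` (px8 g14, over GEOM∘ ✓p763878, ⟨FLOOR₁⟩ ✓p764768, ⟨HAAR-TUBE₁-REL⟩ ✓p765245, the
l.s.c.-floor engine ✓p764381∕p764834 and the WREG charts); the K-UNIFORM letters ⟨UP⟩∕⟨LOW on S′⟩ it consumes are produced here from (5) both halves (✓p765506 + §1 + ✓p765307 §1∕§2), `γ₁`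
shrunk by lit ✓`exists_gamma_forall_θBal_le` so that `θ_{J+1}(c·b₀) ≤ δ` for all `J`.  SO THE PERSISTENCE ROW'S WHOLE DEBT IS PRINT'S THEOREM 1 FOR THE PINNED `ℰp` DENSITIES (the cell's
construction statement = pub-balaban3d's end theorem), in print's own currency.  HONEST SCOPE: a door; Theorem 1 (5) is NOT proved here; PERS₁∘∕POS∘∕LFR♯ᶜ∘∕S2β∕20520∕`YM3TorusSU2` NOT
proved; the Yang–Mills mass gap is NOT proved. [cite: Balaban1985UV3, (1)-(6) pp.256-257, Thm 1 p.257; Balaban1985Averaging, Prop. 1 p.22] -/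
theorem oneLevelPersistenceIntCan_of_bounds5TwoSided
    (h : ∀ (L : ℕ), ∃ c₀ : ℝ, 0 < c₀ ∧ c₀ ≤ 1 ∧ ∀ (c : ℝ), 0 < c → c ≤ c₀ → ∃ pS : ℝ, ∀ (b₀ p₀ : ℝ), 0 < b₀ → pS ≤ p₀ → 0 < p₀ →
      ∃ δ : ℝ, 0 < δ ∧ ∃ γ₁ : ℝ, 0 < γ₁ ∧ ∀ (F : T3Family) (γ : ℝ), F.L = L → 0 < γ → γ ≤ γ₁ →
        ∃ E : ℕ → ℝ, Bounds5UpperAtHeight F γ E ∧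
          ∀ n : ℕ, ∃ cn : ℝ, 0 < cn ∧ ∀ (K : ℕ) (hK : n ≤ K),
            ∀ᵐ V ∂(fieldMeasure (F.P n) 0 (Matrix.specialUnitaryGroup (Fin 2) ℂ)), PlaqSmall δ V →
              cn ≤ Real.exp (-E K) * heightDensity F γ hK Set.univ V) :
    ∀ (L : ℕ), ∃ c₀ : ℝ, 0 < c₀ ∧ c₀ ≤ 1 ∧ ∀ (c : ℝ), 0 < c → c ≤ c₀ → ∃ pS : ℝ, ∀ (b₀ p₀ : ℝ), 0 < b₀ → pS ≤ p₀ → 0 < p₀ →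
      ∃ γ₁ : ℝ, 0 < γ₁ ∧ ∀ (F : T3Family) (γ : ℝ), F.L = L → 0 < γ → γ ≤ γ₁ →
        ∀ (J : ℕ), ∃ q : ℝ, 0 < q ∧ ∀ (K : ℕ) (hJK : J + 1 ≤ K)
          (B : Set (GaugeField (F.P J) 0 (Matrix.specialUnitaryGroup (Fin 2) ℂ))), MeasurableSet B →
            B ⊆ {U | PlaqSmall (θBal F.L γ (c * b₀) p₀ J) U} →
            ENNReal.ofReal q * gibbsK F ℰp γ K (descendTo F ℰp J K ((Nat.le_succ J).trans hJK) ⁻¹' B) ≤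
              gibbsK F ℰp γ K (descendTo F ℰp J K ((Nat.le_succ J).trans hJK) ⁻¹' B ∩
                descendTo F ℰp (J + 1) K hJK ⁻¹' {V | PlaqSmall (θBal F.L γ (c * b₀) p₀ (J + 1)) V}) := by
  refine oneLevelPersistenceIntCan_of_up_low fun L => ?_
  obtain ⟨c₀, hc₀, hc₀1, hc⟩ := h L
  refine ⟨c₀, hc₀, hc₀1, fun c hcpos hcle => ?_⟩
  obtain ⟨pS, hpS⟩ := hc c hcpos hcle
  refine ⟨pS, fun b₀ p₀ hb₀ hpS' hp₀ => ?_⟩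
  obtain ⟨δ, hδ, γ₁, hγ₁, hγ₁F⟩ := hpS b₀ p₀ hb₀ hpS' hp₀
  obtain ⟨γθ, hγθ, -, hθ⟩ := exists_gamma_forall_θBal_le (b₀ := c * b₀) (p₀ := p₀) (mul_pos hcpos hb₀) hp₀ hδ
  refine ⟨min γ₁ γθ, lt_min hγ₁ hγθ, fun F γ hFL hγ hγle J => ?_⟩
  obtain ⟨E, h5, h5low⟩ := hγ₁F F γ hFL hγ (hγle.trans (min_le_left _ _))
  have hL1 : 1 ≤ F.L := F.hL.2.le
  have hθle : ∀ i : ℕ, θBal F.L γ (c * b₀) p₀ i ≤ δ := hθ F.L hL1 γ hγ (hγle.trans (min_le_right _ _))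
  have hup : HeightwiseUpperBound F γ := by
    refine heightwiseUpperBound_of_bounds5TwoSided hγ.le h5 ⟨δ, ?_⟩
    obtain ⟨c0, hc0, h0⟩ := h5low 0
    exact ⟨c0, hδ, hc0, fun K => h0 K (Nat.zero_le K)⟩
  obtain ⟨C, hC, hUP⟩ := up_of_heightwiseUpperBound F hγ.le hup J
  obtain ⟨cl, hcl, hlow⟩ := heightwiseLowerUniform_of_bounds5TwoSided hγ.le h5 hδ h5low (J + 1)
  refine ⟨C, cl, hC, hcl, fun K hJK => ⟨hUP K hJK _, ?_⟩⟩
  refine low_of_heightwiseLowerDensity F hγ.le hJK (measurableSet_plaqSmall _) ?_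
  filter_upwards [hlow K hJK] with V hV hVs
  exact hV (fun p => (hVs p).trans_le (hθle (J + 1)))


/-! ## §6 (v1.2) The edition of record in print's currency: PRINT'S OWN WINDOW (7) `|U(∂p) − 1| < g_kp(g_k) = θBal_n(b₀)` -/
/-- ★★★★ **PERS₁∘ VERBATIM ⟸ THEOREM 1 (5), BOTH HALVES, WITH PRINT'S OWN (γ-SCALED) WINDOW — AND NOTHING ELSE.**  [Balaban1985UV3] p.256 (4): `χ` = `1{|U(∂p) − 1| < ε₁}`,
«ε₁ … will be chosen later»; p.257 after (7): «we take ε₁ = g₀p(g₀), p(g) = b₀(1 + log g⁻¹)^{p₀}»; step `k`: `ε₁ = g_kp(g_k)` ((40), (47), p.267).  At height `n`: `g_{K−n}p(g_{K−n}) =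
θBal F.L γ b₀ p₀ n` (lit `θBal`) — K-free, γ-scaled.  PERS₁∘'s interior window `θ_{J+1}(c·b₀)` is a SUB-window for `c ≤ 1` (lit ✓`θBal_mul_le`, `γ ≤ 1`): NO γ-shrinking, NO displayed
compatibility.  Hypothesis = PERS₁∘'s prefix (`γ₁ ≤ 1`) with, after `F, γ`, `∃ E, Bounds5UpperAtHeight F γ E ∧ ∀ n, ∃ c_n > 0, ∀ K ≥ n, ∀ᵐ V, PlaqSmall θBal_n(b₀) V → c_n ≤ e^{−E_K}ρ_{K−n}(V)`
⟹ PERS₁∘ byte for byte (✓`oneLevelPersistenceIntCan_of_up_low`, ✓p765506, ✓p765307); §5 = the absolute-window strengthening, LEAD's ✓`…PersistenceFromThm1` = the quotient-currency twin.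
HONEST SCOPE: a door; Theorem 1 (5) NOT proved; PERS₁∘∕LFR♯ᶜ∘∕S2β∕20520 NOT proved. [cite: Balaban1985UV3, (4)-(5) p.256, (7) p.257, (47) p.267, Thm 1 p.257] -/
theorem oneLevelPersistenceIntCan_of_bounds5TwoSided_balabanWindow
    (h : ∀ (L : ℕ), ∃ c₀ : ℝ, 0 < c₀ ∧ c₀ ≤ 1 ∧ ∀ (c : ℝ), 0 < c → c ≤ c₀ → ∃ pS : ℝ, ∀ (b₀ p₀ : ℝ), 0 < b₀ → pS ≤ p₀ → 0 < p₀ →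
      ∃ γ₁ : ℝ, 0 < γ₁ ∧ γ₁ ≤ 1 ∧ ∀ (F : T3Family) (γ : ℝ), F.L = L → 0 < γ → γ ≤ γ₁ →
        ∃ E : ℕ → ℝ, Bounds5UpperAtHeight F γ E ∧
          ∀ n : ℕ, ∃ cn : ℝ, 0 < cn ∧ ∀ (K : ℕ) (hK : n ≤ K),
            ∀ᵐ V ∂(fieldMeasure (F.P n) 0 (Matrix.specialUnitaryGroup (Fin 2) ℂ)), PlaqSmall (θBal F.L γ b₀ p₀ n) V →
              cn ≤ Real.exp (-E K) * heightDensity F γ hK Set.univ V) :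
    ∀ (L : ℕ), ∃ c₀ : ℝ, 0 < c₀ ∧ c₀ ≤ 1 ∧ ∀ (c : ℝ), 0 < c → c ≤ c₀ → ∃ pS : ℝ, ∀ (b₀ p₀ : ℝ), 0 < b₀ → pS ≤ p₀ → 0 < p₀ →
      ∃ γ₁ : ℝ, 0 < γ₁ ∧ ∀ (F : T3Family) (γ : ℝ), F.L = L → 0 < γ → γ ≤ γ₁ →
        ∀ (J : ℕ), ∃ q : ℝ, 0 < q ∧ ∀ (K : ℕ) (hJK : J + 1 ≤ K)
          (B : Set (GaugeField (F.P J) 0 (Matrix.specialUnitaryGroup (Fin 2) ℂ))), MeasurableSet B →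
            B ⊆ {U | PlaqSmall (θBal F.L γ (c * b₀) p₀ J) U} →
            ENNReal.ofReal q * gibbsK F ℰp γ K (descendTo F ℰp J K ((Nat.le_succ J).trans hJK) ⁻¹' B) ≤
              gibbsK F ℰp γ K (descendTo F ℰp J K ((Nat.le_succ J).trans hJK) ⁻¹' B ∩
                descendTo F ℰp (J + 1) K hJK ⁻¹' {V | PlaqSmall (θBal F.L γ (c * b₀) p₀ (J + 1)) V}) := by
  refine oneLevelPersistenceIntCan_of_up_low fun L => ?_
  obtain ⟨c₀, hc₀, hc₀1, hc⟩ := h L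
  refine ⟨c₀, hc₀, hc₀1, fun c hcpos hcle => ?_⟩
  obtain ⟨pS, hpS⟩ := hc c hcpos hcle
  refine ⟨pS, fun b₀ p₀ hb₀ hpS' hp₀ => ?_⟩
  obtain ⟨γ₁, hγ₁, hγ₁1, hγ₁F⟩ := hpS b₀ p₀ hb₀ hpS' hp₀
  refine ⟨γ₁, hγ₁, fun F γ hFL hγ hγle J => ?_⟩
  obtain ⟨E, h5, h5low⟩ := hγ₁F F γ hFL hγ hγle
  have hL1 : 1 ≤ F.L := F.hL.2.le
  have hγ1 : γ ≤ 1 := hγle.trans hγ₁1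
  have hθle := T3InteriorExcision.θBal_mul_le hL1 hγ hγ1 hb₀ (hcle.trans hc₀1) p₀ (J + 1)
  have hup : HeightwiseUpperBound F γ := by
    obtain ⟨c0, hc0, h0⟩ := h5low 0
    refine heightwiseUpperBound_of_bounds5TwoSided hγ.le h5 ⟨θBal F.L γ b₀ p₀ 0, c0, ?_, hc0, fun K => h0 K (Nat.zero_le K)⟩
    exact T3MinimiserStabilityReduction.θBal_pos hL1 hγ hγ1 hb₀ p₀ 0
  obtain ⟨C, hC, hUP⟩ := up_of_heightwiseUpperBound F hγ.le hup J
  obtain ⟨⟨cJ, hcJ, hlowJ⟩, ⟨O1, hO1⟩⟩ := And.intro (h5low (J + 1)) (h5 (J + 1))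
  have hθpos := T3MinimiserStabilityReduction.θBal_pos hL1 hγ hγ1 hb₀ p₀ (J + 1)
  haveI := isProbabilityMeasure_fieldMeasure (G := Matrix.specialUnitaryGroup (Fin 2) ℂ) (F.P (J + 1)) 0
  refine ⟨C, cJ / Real.exp (O1 * ((F.P (J + 1)).sitesPerDir 0 : ℝ) ^ 3), hC, div_pos hcJ (Real.exp_pos _), fun K hJK => ⟨hUP K hJK _, ?_⟩⟩
  refine low_of_heightwiseLowerDensity F hγ.le hJK (measurableSet_plaqSmall _) ?_
  obtain ⟨hdm, hdi⟩ := heightDensity_props F hJK MeasurableSet.univ hγ.le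
  have hq := quotient_lower_ae (μ := fieldMeasure (F.P (J + 1)) 0 (Matrix.specialUnitaryGroup (Fin 2) ℂ)) hdi
    (heightDensity_nonneg F γ hJK Set.univ) (measurableSet_plaqSmall_window (F.P (J + 1)) 0 (θBal F.L γ b₀ p₀ (J + 1)))
    (measureReal_plaqSmall_pos (F.P (J + 1)) 0 hθpos) (Real.exp_pos (-E K)) hcJ (hO1 K hJK) (hlowJ K hJK)
  rw [integral_heightDensity_univ_eq_partitionFn F hγ.le hJK] at hq
  filter_upwards [hq] with V hV hVs
  exact hV (fun p => (hVs p).trans_le hθle)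

end Summit.QuantumFields.YangMills.Theorems.FluctuationComparisonRegPrIntLHeightwisePersistenceOfBounds5

end
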